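import Summits.HubbardSuperconductivity.HubbardSuperconductivity.Theses.EnslavedA1g
import Summits.HubbardSuperconductivity.HubbardSuperconductivity.Theorems.TwTipContinuation.Negative.TipNormalForm
import Literature.MathematicalPhysics.QuantumLattice.LocalPairOn
import Literature.MathematicalPhysics.QuantumLattice.PairCorrelationsProofs

/-!
# Route `EnslavedA1g` — the bond parallelogram and the glue items

* `BondParallelogram` (stmt-HubbardSuperconductivity-0940): the operator identity
  `Δ_{s*}†Δ_{s*} + Δ_d†Δ_d = 2 (Δ_{+}†Δ_{+} + Δ_{-}†Δ_{-})`, `Δ_± = Δ_{(s* ± d)/2} = (Δ_{s*} ± Δ_d)/2`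
  (linearity of the pair field in its form factor, `pairFieldOn_add` / `pairFieldOn_smul`, and the
  parallelogram law in a noncommutative algebra).
* `CruxesGiveBondCondensate` (stmt-HubbardSuperconductivity-14254): `NoOnsiteODLRO →
  A1gSlavingTransfer → BondSingletCondensation → BondCondensateWithoutA1g` (bookkeeping).
* `BondCondensateGivesSummit` (stmt-HubbardSuperconductivity-14260): `BondCondensateWithoutA1g →
  HubbardSuperconductivity`: at large even `L`, `Re⟨Δ_d†Δ_d⟩ = 2 Re⟨Δ_+†Δ_+ + Δ_-†Δ_-⟩ -
  Re⟨Δ_{s*}†Δ_{s*}⟩ ≥ 2aL⁴ - aL⁴`, and the even-side `liminf` bookkeeping (with the a-priori cap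
  `expect_pairIntensity_le`) gives the summit's matrix.
* `Assembly` (stmt-HubbardSuperconductivity-0941): the composition.

Sources: D. J. Scalapino, Phys. Rep. 250 (1995) 329, §2 eqs. (2.2)–(2.4); S.-C. Zhang, Phys. Rev.
Lett. 65 (1990) 120 (η/s-wave slaving). No new definitions.
-/

-- the mandated namespace `Summit.<Summit>.<Problem>.Theorems` repeats `HubbardSuperconductivity`
-- (single-problem summit, D-0017), which the `dupNamespace` linter flags on every declaration
set_option linter.dupNamespace false

namespace Summit.HubbardSuperconductivity.HubbardSuperconductivity.Theorems.EnslavedA1g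

open Matrix Filter Literature.MathematicalPhysics.QuantumLattice Literature.Probability.LatticeModels
open Summit.HubbardSuperconductivity.HubbardSuperconductivity.Theses.EnslavedA1g
open Summit.HubbardSuperconductivity.TwTipContinuation.Negative
  (lroTerm_eq expect_pairIntensity_le side_pow_pos)

/-- The parallelogram law in a (noncommutative) `ℂ`-algebra, in the form used for the bond pair
fields: `A'A + B'B = 2 • ((½(A'+B'))(½(A+B)) + (½(A'-B'))(½(A-B)))`. [folklore] -/
theorem parallelogram_alg {R : Type*} [Ring R] [Algebra ℂ R] (A B A' B' : R) :
    A' * A + B' * B = (2 : ℂ) • ((((1 / 2 : ℝ) : ℂ) • (A' + B')) * ((((1 / 2 : ℝ) : ℂ)) • (A + B)) +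
      (((1 / 2 : ℝ) : ℂ) • (A' - B')) * ((((1 / 2 : ℝ) : ℂ)) • (A - B))) := by
  simp only [smul_mul_assoc, mul_smul_comm, smul_smul, add_mul, mul_add, sub_mul, mul_sub, smul_add,
    smul_sub]
  push_cast
  module

/-- **`BondParallelogram`** (stmt-HubbardSuperconductivity-0940): for every side `L`,
`Δ_{s*}†Δ_{s*} + Δ_d†Δ_d = 2 • (Δ_+†Δ_+ + Δ_-†Δ_-)` with `Δ_± = Δ_{(s* ± d)/2}`; indeed the pair
field is linear in its form factor, so `Δ_± = ½(Δ_{s*} ± Δ_d)`, and the parallelogram law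
applies. Scalapino, Phys. Rep. 250 (1995) 329, §2 eq. (2.2). [folklore] -/
theorem bondParallelogram_proof :
    Summit.HubbardSuperconductivity.HubbardSuperconductivity.Theses.EnslavedA1g.BondParallelogram := by
  unfold BondParallelogram
  intro L _
  have hp : (fun e => (extendedSWave e + dWaveFormFactor e) / 2) =
      (1 / 2 : ℝ) • (extendedSWave + dWaveFormFactor) := by
    funext e; simp only [Pi.smul_apply, Pi.add_apply, smul_eq_mul]; ring
  have hm : (fun e => (extendedSWave e - dWaveFormFactor e) / 2) =
      (1 / 2 : ℝ) • (extendedSWave + (-1 : ℝ) • dWaveFormFactor) := by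
    funext e; simp only [Pi.smul_apply, Pi.add_apply, smul_eq_mul]; ring
  rw [hp, hm]
  simp only [← pairFieldOn_insert_zero_unitSteps]
  rw [pairFieldOn_smul, pairFieldOn_smul, pairFieldOn_add, pairFieldOn_add, pairFieldOn_smul]
  set A := pairFieldOn (insert 0 unitSteps) extendedSWave L
  set B := pairFieldOn (insert 0 unitSteps) dWaveFormFactor L
  have hneg : A + ((-1 : ℝ) : ℂ) • B = A - B := by
    push_cast; rw [neg_one_smul, sub_eq_add_neg]
  rw [hneg, conjTranspose_smul, conjTranspose_smul, conjTranspose_add, conjTranspose_sub]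
  have hstar : star (((1 / 2 : ℝ)) : ℂ) = (((1 / 2 : ℝ)) : ℂ) := Complex.conj_ofReal _
  rw [hstar]
  exact parallelogram_alg A B Aᴴ Bᴴ

/-- **`CruxesGiveBondCondensate`** (stmt-HubbardSuperconductivity-14254): `NoOnsiteODLRO →
A1gSlavingTransfer → BondSingletCondensation → BondCondensateWithoutA1g`. Take `(U, δ, a)` from
the bond-singlet condensation; for a summit family the bond-condensate clause is that crux, and
the extended-`s` smallness is the slaving transfer fed with the on-site smallness.
Zhang, Phys. Rev. Lett. 65 (1990) 120; Scalapino, Phys. Rep. 250 (1995) 329, §2. [folklore] -/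
theorem cruxesGiveBondCondensate_proof :
    Summit.HubbardSuperconductivity.HubbardSuperconductivity.Theses.EnslavedA1g.CruxesGiveBondCondensate := by
  unfold CruxesGiveBondCondensate NoOnsiteODLRO A1gSlavingTransfer BondSingletCondensation
    BondCondensateWithoutA1g
  rintro hNo hTr ⟨U, hU, δ, hδ, a, ha, hB⟩
  refine ⟨U, hU, δ, hδ, a, ha, fun N ψ hyp => ⟨hB N ψ hyp, ?_⟩⟩
  exact hTr U δ hU hδ N ψ hyp (hNo U δ hU hδ N ψ hyp)

/-- **`BondCondensateGivesSummit`** (stmt-HubbardSuperconductivity-14260):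
`BondCondensateWithoutA1g → HubbardSuperconductivity` with the same `(U, δ)`. For a summit
family, at every even `L` beyond both thresholds (the bond floor `a ≤ L⁻⁴ Re⟨Δ_+†Δ_+ + Δ_-†Δ_-⟩`
and the extended-`s` smallness with `ε := a`), the bond parallelogram gives
`Re⟨Δ_d†Δ_d⟩ = 2 Re⟨Δ_+†Δ_+ + Δ_-†Δ_-⟩ - Re⟨Δ_{s*}†Δ_{s*}⟩ ≥ a L⁴`; the even-side `liminf`
bookkeeping (`lroTerm_eq`, a-priori cap `expect_pairIntensity_le`) then yields
`HasLongRangeOrder`. Scalapino, Phys. Rep. 250 (1995) 329, §2 eq. (2.4). [folklore] -/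
theorem bondCondensateGivesSummit_proof :
    Summit.HubbardSuperconductivity.HubbardSuperconductivity.Theses.EnslavedA1g.BondCondensateGivesSummit := by
  unfold BondCondensateGivesSummit BondCondensateWithoutA1g
  rintro ⟨U, hU, δ, hδ, a, ha, h⟩
  unfold _root_.HubbardSuperconductivity Literature.Hubbard.DWaveSuperconductivityHubbard
  refine ⟨U, hU, δ, hδ, fun N ψ hyp => ?_⟩
  obtain ⟨⟨L₀, hlow⟩, hsmall⟩ := h N ψ hyp
  obtain ⟨L₁, hs⟩ := hsmall a ha
  -- the d-wave floor at every large even side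
  have hfloor : ∀ (L : ℕ) [NeZero L], Even L → max L₀ L₁ ≤ L →
      a * (L : ℝ) ^ 4 ≤ (expect ((pairField dWaveFormFactor L)ᴴ * pairField dWaveFormFactor L)
        (ψ L)).re := by
    intro L _ hE hL
    have hL' : (0 : ℝ) < (L : ℝ) := Nat.cast_pos.2 (Nat.pos_of_ne_zero (NeZero.ne L))
    have hL4 : (0 : ℝ) < (L : ℝ) ^ 4 := by positivity
    have h1 := hlow L hE (le_trans (le_max_left _ _) hL)
    have h2 := hs L hE (le_trans (le_max_right _ _) hL)
    rw [le_div_iff₀ hL4] at h1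
    rw [div_le_iff₀ hL4] at h2
    -- the parallelogram identity in expectation
    have hpar := congrArg (fun X => (expect X (ψ L)).re) (bondParallelogram_proof L)
    simp only [expect_add, expect_smul, Complex.add_re, Complex.mul_re, Complex.re_ofNat,
      Complex.im_ofNat, zero_mul, sub_zero] at hpar
    linarith
  -- the even-side `liminf` bookkeeping
  change 0 < liminf (fun k : ℕ => (∑ x ∈ halfOpenBox 2 (2 * k), ∑ y ∈ halfOpenBox 2 (2 * k),
          torusPullback (pairFieldCorr dWaveFormFactor ψ) (2 * k) x y) /
        ((halfOpenBox 2 (2 * k)).card : ℝ) ^ 2) atTop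
  have hev : ∀ᶠ k in atTop, a ≤ (∑ x ∈ halfOpenBox 2 (2 * k), ∑ y ∈ halfOpenBox 2 (2 * k),
          torusPullback (pairFieldCorr dWaveFormFactor ψ) (2 * k) x y) /
        ((halfOpenBox 2 (2 * k)).card : ℝ) ^ 2 := by
    refine eventually_atTop.2 ⟨max L₀ L₁ + 1, fun k hk => ?_⟩
    haveI : NeZero (2 * k) := ⟨by omega⟩
    rw [lroTerm_eq, le_div_iff₀ (side_pow_pos k)]
    exact hfloor (2 * k) (even_two_mul k) (by omega)
  have hev' : ∀ᶠ k in atTop, (∑ x ∈ halfOpenBox 2 (2 * k), ∑ y ∈ halfOpenBox 2 (2 * k),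
          torusPullback (pairFieldCorr dWaveFormFactor ψ) (2 * k) x y) /
        ((halfOpenBox 2 (2 * k)).card : ℝ) ^ 2 ≤
      (∑ e ∈ insert 0 unitSteps, ‖((dWaveFormFactor e / Real.sqrt 2 : ℝ) : ℂ)‖ * 2) ^ 2 := by
    refine eventually_atTop.2 ⟨1, fun k hk => ?_⟩
    haveI : NeZero (2 * k) := ⟨by omega⟩
    obtain ⟨-, hu, -⟩ := hyp (2 * k) (even_two_mul k)
    rw [lroTerm_eq, div_le_iff₀ (side_pow_pos k)]
    exact expect_pairIntensity_le (2 * k) (ψ (2 * k)) hu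
  exact lt_of_lt_of_le ha (le_liminf_of_le (isCoboundedUnder_ge_of_eventually_le _ hev') hev)

/-- **Assembly of route `EnslavedA1g`** (stmt-HubbardSuperconductivity-0941): the bodies of
`NoOnsiteODLRO`, `A1gSlavingTransfer` and `BondSingletCondensation` imply the summit — the
composition `bondCondensateGivesSummit_proof (cruxesGiveBondCondensate_proof …)`.
Scalapino, Phys. Rep. 250 (1995) 329, §2. [folklore] -/
theorem enslavedA1g_assembly_proof :
    Summit.HubbardSuperconductivity.HubbardSuperconductivity.Theses.EnslavedA1g.Assembly := by
  intro hNo hTr hB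
  exact bondCondensateGivesSummit_proof (cruxesGiveBondCondensate_proof hNo hTr hB)

end Summit.HubbardSuperconductivity.HubbardSuperconductivity.Theorems.EnslavedA1g
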